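import Summits.KontsevichZagierPeriods.Zeta5Search.LaiSweepShard

/-!
# `κ₃` sweep certificate — shard file 092 of 127 (shards 644–650 of 889)

HONEST FRAMING. Systematic search; no irrationality claim unless certified. This file only checks,
by `decide +kernel`, shards 644–650 of the order-cell sweep of the `κ₃` point `(74, 2180, 444; δ74)`
(engine `LaiSweepEngine`, soundness `LaiSweepJump/Free/Eval/Shard/Kappa3`; a shard is `⟨regime, n,
p, q, p', q', Lo, Up⟩`: `n` cells from `p/q` to `p'/q'` with integer rate sums in `[Lo, Up]`, `K =
128`, `D = 2^40`). It draws NO conclusion: only the capstone `LaiKappa3SweepCert`, which needs all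
127 shard files, does. Kernel cost of this file ≈ 560 cells × 0.3 s.
-/

namespace Summit.KontsevichZagierPeriods.Zeta5Search.Sweep

set_option maxHeartbeats 100000000 in
/-- Shard 644: 80 cells of regime B from `227/328` to `147/212`.
[cite: Lai2024BallRivoal, §4 Lemma 4.3] -/
theorem shard644 :
    Shard.check 128 (2^40)
      ⟨true, 80, 227, 328, 147, 212, 12753342452690, 18124677562087⟩ = true := by
  decide +kernel

set_option maxHeartbeats 100000000 in
/-- Shard 645: 80 cells of regime B from `147/212` to `248/357`.
[cite: Lai2024BallRivoal, §4 Lemma 4.3] -/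
theorem shard645 :
    Shard.check 128 (2^40)
      ⟨true, 80, 147, 212, 248, 357, 12341903291938, 17558632210552⟩ = true := by
  decide +kernel

set_option maxHeartbeats 100000000 in
/-- Shard 646: 80 cells of regime B from `248/357` to `190/273`.
[cite: Lai2024BallRivoal, §4 Lemma 4.3] -/
theorem shard646 :
    Shard.check 128 (2^40)
      ⟨true, 80, 248, 357, 190, 273, 12433153048035, 17707493268699⟩ = true := by
  decide +kernel

set_option maxHeartbeats 100000000 in
/-- Shard 647: 80 cells of regime B from `190/273` to `251/360`.
[cite: Lai2024BallRivoal, §4 Lemma 4.3] -/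
theorem shard647 :
    Shard.check 128 (2^40)
      ⟨true, 80, 190, 273, 251, 360, 12030834820842, 17152603009773⟩ = true := by
  decide +kernel

set_option maxHeartbeats 100000000 in
/-- Shard 648: 80 cells of regime B from `251/360` to `183/262`.
[cite: Lai2024BallRivoal, §4 Lemma 4.3] -/
theorem shard648 :
    Shard.check 128 (2^40)
      ⟨true, 80, 251, 360, 183, 262, 12003567818915, 17131595340308⟩ = true := by
  decide +kernel

set_option maxHeartbeats 100000000 in
/-- Shard 649: 80 cells of regime B from `183/262` to `205/293`.
[cite: Lai2024BallRivoal, §4 Lemma 4.3] -/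
theorem shard649 :
    Shard.check 128 (2^40)
      ⟨true, 80, 183, 262, 205, 293, 11362906974947, 16233653072057⟩ = true := by
  decide +kernel

set_option maxHeartbeats 100000000 in
/-- Shard 650: 80 cells of regime B from `205/293` to `211/301`.
[cite: Lai2024BallRivoal, §4 Lemma 4.3] -/
theorem shard650 :
    Shard.check 128 (2^40)
      ⟨true, 80, 205, 293, 211, 301, 12799093623620, 18305266833089⟩ = true := by
  decide +kernel

/-- The checked shards of this file, in order. [folklore] -/
def shards092 : List (CheckedShard 128 (2^40)) :=
  [⟨_, shard644⟩, ⟨_, shard645⟩, ⟨_, shard646⟩, ⟨_, shard647⟩, ⟨_, shard648⟩,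
    ⟨_, shard649⟩, ⟨_, shard650⟩]

end Summit.KontsevichZagierPeriods.Zeta5Search.Sweep
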